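import Mathlib
import Summits.Ventures.PercRepro2.SwOutCrossGenBitK

/-!
# Iterating the extra vertex: the minimal fibre data and the bit construction (blind cell
PercRepro2, night-4 g24, 2026-08-28; proofs/NIGHT4-G24.md §10)

The theorem with one extra dropped vertex (`card_le_crossGenBit`) used the fibre data of the
component only through ITS INEQUALITY (`card_le_crossGen`) and the injection `theta`.  So the
extended fibre can be extended again: `FibreIter` keeps the definitional fields (the flip, the red
atoms, the red-side leak, the label and its order, `theta` with its two axioms) and `Ineq F ι` is
the inequality on the cube over `ι`; `FibreIter.ofBit` forgets a `FibreDataBit` (its inequality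
is `card_le_crossGen`), and **`FibreIter.bit`** adds a dropped vertex: the product fibre with the
product leak, the vertex's atom, the vertex's outside bit in the label, and the injection
`theta'(w, v) = (theta w, σ v)` with `σ` sending the vertex's states dropped-red ↦ attached-red,
attached-blue ↦ dropped-red, dropped-blue ↦ attached-blue.  The inequality of `F.bit` from that of
`F` is `SwOutCrossGenIterThm`; `bitN` iterates.
-/

namespace Summit.Ventures.PercRepro2

namespace CrossArm

/-- **The minimal fibre data**: the definitional fields and the injection `theta`. -/
structure FibreIter (W A L : Type*) where
  /-- the flip of a fibre point -/
  flip : W → W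
  /-- the flip is an involution -/
  flip_flip : ∀ w, flip (flip w) = w
  /-- the red fibre atoms of a point, when `u` is red -/
  red : W → A → Bool
  /-- the red-side leak of a point -/
  leakR : W → Bool
  /-- the label of a point -/
  label : W → L
  /-- `BetterL l' l`: `l'` is at least as good a label as `l` -/
  BetterL : L → L → Prop
  /-- `BetterL` is reflexive -/
  betterL_refl : ∀ l, BetterL l l
  /-- the injection of the non-red-leaking points -/
  theta : W → W
  /-- `theta` lands in the non-blue-leaking points, with a better label, its flip carrying the
  red atoms of the source -/
  theta_ok : ∀ w, leakR w = false →
    leakR (flip (theta w)) = false ∧ BetterL (label (theta w)) (label w) ∧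
      ∀ a, red w a = true → red (flip (theta w)) a = true
  /-- `theta` is injective on the non-red-leaking points -/
  theta_inj : ∀ w w', leakR w = false → leakR w' = false → theta w = theta w' → w = w'

section Cube

variable {W A L : Type*} {ι : Type*} (F : FibreIter W A L)

/-- The leak of a point. -/
def LeakI (q : PtG W ι) : Prop :=
  (redUG q.1 ∧ F.leakR q.2 = true) ∨ (blueUG q.1 ∧ F.leakR (F.flip q.2) = true)

/-- The red atoms of a point. -/
def ERI (q : PtG W ι) : Set (AtomG A ι) := fun a =>
  match a with
  | Sum.inl j => q.1 j = true
  | Sum.inr (Sum.inl _) => redUG q.1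
  | Sum.inr (Sum.inr a) => redUG q.1 ∧ F.red q.2 a = true

/-- The total flip of a point. -/
def flipI (q : PtG W ι) : PtG W ι := (flipAll q.1, F.flip q.2)

/-- The blue atoms: the red atoms of the flip. -/
def EBI (q : PtG W ι) : Set (AtomG A ι) := ERI F (flipI F q)

/-- The type of a point. -/
def typI (q : PtG W ι) : TypG L ι := (q.1, F.label q.2)

/-- `t'` is at least as good a type as `t`. -/
def BetterI (t' t : TypG L ι) : Prop :=
  (∀ j, t.1 j = false → t'.1 j = false) ∧ F.BetterL t'.2 t.2

/-- An up-set of types. -/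
def IsUpI (𝒯 : Set (TypG L ι)) : Prop := ∀ t ∈ 𝒯, ∀ t', BetterI F t' t → t' ∈ 𝒯

variable [Fintype ι] [DecidableEq ι] [Fintype W] [DecidableEq W]

open scoped Classical in
/-- The non-leaking points whose type lies in `𝒯`. -/
noncomputable def QI (𝒯 : Set (TypG L ι)) : Finset (PtG W ι) :=
  Finset.univ.filter fun q => ¬ LeakI F q ∧ typI F q ∈ 𝒯

open scoped Classical in
/-- **The inequality on the cube over `ι`.** -/
def Ineq : Prop :=
  ∀ (𝒯 : Set (TypG L ι)) (𝓔 : Set (Set (AtomG A ι))), IsUpI F 𝒯 → IsUpperSet 𝓔 →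
    ((QI F 𝒯).filter fun q => ERI F q ∈ 𝓔).card ≤ ((QI F 𝒯).filter fun q => EBI F q ∈ 𝓔).card

omit [DecidableEq W] in
open scoped Classical in
/-- Membership in `QI`. -/
lemma mem_QI {𝒯 : Set (TypG L ι)} {q : PtG W ι} : q ∈ QI F 𝒯 ↔ ¬ LeakI F q ∧ typI F q ∈ 𝒯 := by
  simp only [QI, Finset.mem_filter, Finset.mem_univ, true_and]

omit [Fintype ι] [DecidableEq ι] [Fintype W] [DecidableEq W] in
/-- On the B-slab the red atoms are empty. -/
lemma ERI_sBot (w : W) : ERI F ((sBotG : Config ι), w) = ∅ := by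
  ext a
  simp only [Set.mem_empty_iff_false, iff_false]
  rcases a with j | (u | a)
  · exact fun h => Bool.noConfusion h
  · exact fun h => not_redUG_bot h
  · exact fun h => not_redUG_bot h.1

end Cube

section OfBit

variable {W A L : Type*}

/-- A `FibreDataBit` forgets to a `FibreIter`. -/
def FibreIter.ofBit (F : FibreDataBit W A L) : FibreIter W A L where
  flip := F.flip
  flip_flip := F.flip_flip
  red := F.red
  leakR := F.leakR
  label := F.label
  BetterL := F.BetterL
  betterL_refl := F.betterL_refl
  theta := F.theta
  theta_ok := F.theta_ok
  theta_inj := F.theta_inj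

variable {ι : Type*} [Fintype ι] [DecidableEq ι] [Fintype W] [DecidableEq W] [Nonempty ι]

/-- The inequality of a `FibreDataBit` is `card_le_crossGen`. -/
theorem ineq_ofBit (F : FibreDataBit W A L) : Ineq (FibreIter.ofBit F) (ι := ι) := by
  intro 𝒯 𝓔 h𝒯 h𝓔
  exact card_le_crossGen (F := F.toFibreData) (fun t ht t' hle => h𝒯 t ht t' hle) h𝓔

end OfBit

section Bit

variable {W A L : Type*} (F : FibreIter W A L)

/-- The vertex's state after the injection: dropped-red ↦ attached-red, attached-blue ↦
dropped-red, dropped-blue ↦ attached-blue (attached-red, which leaks, ↦ dropped-blue). -/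
def sigmaV : Bool × Bool → Bool × Bool
  | (false, false) => (true, false)
  | (true, true) => (false, false)
  | (false, true) => (true, true)
  | (true, false) => (false, true)

/-- `sigmaV` is injective. -/
lemma sigmaV_injective : Function.Injective sigmaV := by
  rintro ⟨a, b⟩ ⟨a', b'⟩ h
  cases a <;> cases b <;> cases a' <;> cases b' <;> simp [sigmaV] at h <;> rfl

/-- **The bit construction**: the fibre with one more dropped vertex. -/
def FibreIter.bit : FibreIter (W × (Bool × Bool)) (A ⊕ Unit) (L × Bool) where
  flip := fun x => (F.flip x.1, (!x.2.1, !x.2.2))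
  flip_flip := fun x => by simp [F.flip_flip]
  red := fun x a => match a with
    | Sum.inl a => F.red x.1 a
    | Sum.inr _ => x.2.1
  leakR := fun x => F.leakR x.1 || (x.2.1 && !x.2.2)
  label := fun x => (F.label x.1, x.2.2)
  BetterL := fun l' l => F.BetterL l'.1 l.1 ∧ (l.2 = false → l'.2 = false)
  betterL_refl := fun l => ⟨F.betterL_refl _, fun h => h⟩
  theta := fun x => (F.theta x.1, sigmaV x.2)
  theta_ok := fun x hx => by
    obtain ⟨w, a, e⟩ := x
    simp only [Bool.or_eq_false_iff, Bool.and_eq_false_iff] at hx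
    obtain ⟨h1, h2, h3⟩ := F.theta_ok w hx.1
    cases a <;> cases e
    · -- dropped, red outside ↦ attached, red outside
      refine ⟨by simp [sigmaV, h1], ⟨h2, fun _ => rfl⟩, fun a ha => ?_⟩
      cases a with
      | inl a => exact h3 a ha
      | inr _ => simp at ha
    · -- dropped, blue outside ↦ attached, blue outside
      refine ⟨by simp [sigmaV, h1], ⟨h2, fun h => Bool.noConfusion h⟩, fun a ha => ?_⟩
      cases a with
      | inl a => exact h3 a ha
      | inr _ => simp at ha
    · -- attached, red outside: leaks
      exfalso
      rcases hx.2 with h | h <;> exact Bool.noConfusion h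
    · -- attached, blue outside ↦ dropped, red outside
      refine ⟨by simp [sigmaV, h1], ⟨h2, fun h => Bool.noConfusion h⟩, fun a ha => ?_⟩
      cases a with
      | inl a => exact h3 a ha
      | inr _ => rfl
  theta_inj := fun x x' hx hx' h => by
    obtain ⟨w, v⟩ := x
    obtain ⟨w', v'⟩ := x'
    simp only [Bool.or_eq_false_iff] at hx hx'
    simp only [Prod.mk.injEq] at h
    exact Prod.ext (F.theta_inj _ _ hx.1 hx'.1 h.1) (sigmaV_injective h.2)

end Bit

end CrossArm

end Summit.Ventures.PercRepro2
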